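import Summits.NavierStokesRegularity.NavierStokesRegularity.Theorems.LerayQuarterDissipationFiniteDissipationLiouvilleFarFieldTools
import Summits.NavierStokesRegularity.NavierStokesRegularity.Theorems.LerayQuarterDissipationFiniteDissipationLiouvilleFiniteSingularSet
import HarnessLib

/-!
# Crux `FiniteDissipationLiouville` (stmt-NavierStokesRegularity-22144): far-field regularity through
# the singular time — the slice estimates along balls escaping to infinity (file 2/3)

Theorems file of route `LerayQuarterDissipation` (lead prover g4; `--supports` the crux). Navier–Stokes
regularity is NOT proved by anything here; no summit is.

Slice-level steps of the far-field theorem (`…FarField.lean`, file 3/3): for a slice `v = u(t)`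
(`‖v‖₆ ≤ ℓ`), the slice pressure `p₀(t) = Q + C` a.e. (`‖Q‖₃ ≤ C_q ℓ²`) and the LOCAL gauges
`m_{x₀} = ∫ Θ(y) p₀(t, x₀ − y) dy`:

* `sliceFunctional_le_local` (Step A) — `∫_{B(x₀,r)} (|v|³ + |p₀(t) − m_{x₀}|^{3/2})` is bounded by
  positive powers of the norms of `v` and `Q` ON `B̄(x₀, ρ)` only;
* `tendsto_sliceBound_local` (Step B) — hence it tends to `0` along centres `|x_n| ≥ n`;
* `sliceBound_local_le_rate` (Step C) — and it is dominated by `ℓ³ K₀`, `K₀` absolute;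
* `sliceFunctional_dominated_tendsto` (Step D0) — the two combined, per slice.
-/

noncomputable section

-- the summit and its single sub-problem share the name (CONVENTIONS §1), as in every Theorems file
set_option linter.dupNamespace false

namespace Summit.NavierStokesRegularity.NavierStokesRegularity.Theorems.FiniteDissipationLiouville.Birth.Apex

open MeasureTheory Set Filter Topology Metric Function TopologicalSpace
open Literature.Analysis Literature.Analysis.FluidPDE
open scoped ENNReal NNReal

/-! ### Step A: the slice functional with the local gauge, against LOCAL norms -/

/-- **The slice functional with the local gauge is controlled by local norms.** For a slice `v`, a
slice pressure `pr₀ = Q + C` a.e. with `Q ∈ L³`, and the local average `m = ∫ Θ(y) pr₀(x₀ − y) dy`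
(`Θ` a normed bump of outer radius `ρ ≥ r`, `Θ ≤ B_Θ`):
`∫_{B(x₀,r)} (|v|³ + |pr₀ − m|^{3/2}) ≤ a^{1/2} V^{1/2} + √2 (b^{1/2} V^{1/2} + (κ b^{1/3})^{3/2} V)` with
`a = ∫_{B̄(x₀,ρ)} |v|⁶`, `b = ∫_{B̄(x₀,ρ)} |Q|³`, `V = |B(x₀, r)|`, `κ = B_Θ |B̄(x₀,ρ)|^{2/3}`. -/
theorem sliceFunctional_le_local {v : EuclideanSpace ℝ (Fin 3) → EuclideanSpace ℝ (Fin 3)}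
    {pr₀ Q : EuclideanSpace ℝ (Fin 3) → ℝ} {C m BΘ r : ℝ} {x₀ : EuclideanSpace ℝ (Fin 3)}
    {θ : ContDiffBump (0 : EuclideanSpace ℝ (Fin 3))}
    (hv : AEStronglyMeasurable v volume) (hQ : MemLp Q 3 volume)
    (hae : ∀ᵐ x ∂(volume : Measure (EuclideanSpace ℝ (Fin 3))), pr₀ x = Q x + C)
    (hBΘ : ∀ y, θ.normed volume y ≤ BΘ) (hm : m = ∫ y, θ.normed volume y * pr₀ (x₀ - y))
    (hr : r ≤ θ.rOut) :
    ∫⁻ x in ball x₀ r, (‖v x‖ₑ ^ (3 : ℕ) + ‖pr₀ x - m‖ₑ ^ (3 / 2 : ℝ)) ≤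
      (∫⁻ x in closedBall x₀ θ.rOut, ‖v x‖ₑ ^ 6) ^ (1 / 2 : ℝ) * (volume (ball x₀ r)) ^ (1 / 2 : ℝ) +
        (2 : ℝ≥0∞) ^ (1 / 2 : ℝ) *
          ((∫⁻ x in closedBall x₀ θ.rOut, ‖Q x‖ₑ ^ (3 : ℝ)) ^ (1 / 2 : ℝ) *
              (volume (ball x₀ r)) ^ (1 / 2 : ℝ) +
            (ENNReal.ofReal (BΘ * (volume.real (closedBall x₀ θ.rOut)) ^ (2 / 3 : ℝ)) *
              (∫⁻ x in closedBall x₀ θ.rOut, ‖Q x‖ₑ ^ (3 : ℝ)) ^ (1 / 3 : ℝ)) ^ (3 / 2 : ℝ) *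
              volume (ball x₀ r)) := by
  have hsub : ball x₀ r ⊆ closedBall x₀ θ.rOut := ball_subset_closedBall.trans (closedBall_subset_closedBall hr)
  -- the slice with the local gauge: `pr₀ − m = Q + (C − m)` a.e.
  have hae' : ∀ᵐ x ∂(volume : Measure (EuclideanSpace ℝ (Fin 3))), pr₀ x - m = Q x + (C - m) := by
    filter_upwards [hae] with x hx
    rw [hx]; ring
  have h1 := setLIntegral_cube_add_pressure_le_local (pr := fun x => pr₀ x - m) hv hQ.1 hae' (ball x₀ r)
  -- the gauge constant against the local `L³` norm
  have hc : ‖C - m‖ₑ ≤ ENNReal.ofReal (BΘ * (volume.real (closedBall x₀ θ.rOut)) ^ (2 / 3 : ℝ)) *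
      (∫⁻ x in closedBall x₀ θ.rOut, ‖Q x‖ₑ ^ (3 : ℝ)) ^ (1 / 3 : ℝ) := by
    have h := enorm_normaliser_sub_const_le x₀ θ hBΘ hQ hae
    rw [← hm] at h
    have e : eLpNorm Q 3 (volume.restrict (closedBall x₀ θ.rOut)) =
        (∫⁻ x in closedBall x₀ θ.rOut, ‖Q x‖ₑ ^ (3 : ℝ)) ^ (1 / 3 : ℝ) := by
      rw [eLpNorm_eq_lintegral_rpow_enorm_toReal (by norm_num) (by norm_num)]
      norm_num
    rw [← e, show ‖C - m‖ₑ = ‖m - C‖ₑ by rw [← enorm_neg, neg_sub]]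
    exact h
  refine h1.trans ?_
  gcongr

/-! ### Step B: the local norms tend to zero at spatial infinity -/

/-- **Tails along a sequence of balls escaping to infinity**: if `∫ g < ∞` and `‖x_n‖ ≥ n`, then
`∫_{B̄(x_n, ρ)} g → 0`. -/
theorem tendsto_setLIntegral_closedBall_of_norm_ge {g : EuclideanSpace ℝ (Fin 3) → ℝ≥0∞}
    (hfin : ∫⁻ x, g x ≠ ⊤) {x : ℕ → EuclideanSpace ℝ (Fin 3)} (hx : ∀ n : ℕ, (n : ℝ) ≤ ‖x n‖)
    (ρ : ℝ) :
    Tendsto (fun n => ∫⁻ y in closedBall (x n) ρ, g y) atTop (𝓝 0) := by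
  set k : ℕ := ⌈ρ⌉₊ + 1 with hk
  have htail := (tendsto_setLIntegral_compl_closedBall hfin).comp (tendsto_sub_atTop_nat k)
  refine tendsto_of_tendsto_of_tendsto_of_le_of_le' tendsto_const_nhds htail
    (Eventually.of_forall fun _ => zero_le) ?_
  refine (eventually_ge_atTop k).mono fun n hn => lintegral_mono_set fun y hy => ?_
  rw [mem_compl_iff, mem_closedBall, dist_zero_right, not_le]
  rw [mem_closedBall, dist_eq_norm] at hy
  have h1 : ‖x n‖ - ρ ≤ ‖y‖ := by
    have := norm_sub_norm_le (x n) y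
    rw [norm_sub_rev] at hy
    linarith
  have h2 : (((n - k : ℕ) : ℝ)) = (n : ℝ) - k := by rw [Nat.cast_sub hn]
  have h3 : (ρ : ℝ) < k := by
    rw [hk]; push_cast
    linarith [Nat.le_ceil ρ]
  show ((n - k : ℕ) : ℝ) < ‖y‖
  rw [h2]
  linarith [hx n]

/-- **The right-hand side of `sliceFunctional_le_local` tends to `0` along balls escaping to
infinity** (all its terms carry a positive power of a local norm of `v ∈ L⁶` or `Q ∈ L³`). -/
theorem tendsto_sliceBound_local {v : EuclideanSpace ℝ (Fin 3) → EuclideanSpace ℝ (Fin 3)}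
    {Q : EuclideanSpace ℝ (Fin 3) → ℝ} (hv6 : ∫⁻ x, ‖v x‖ₑ ^ 6 ≠ ⊤)
    (hQ3 : ∫⁻ x, ‖Q x‖ₑ ^ (3 : ℝ) ≠ ⊤) {x : ℕ → EuclideanSpace ℝ (Fin 3)} (hx : ∀ n : ℕ, (n : ℝ) ≤ ‖x n‖)
    (ρ r κ : ℝ) :
    Tendsto (fun n =>
      (∫⁻ y in closedBall (x n) ρ, ‖v y‖ₑ ^ 6) ^ (1 / 2 : ℝ) * (volume (ball (x n) r)) ^ (1 / 2 : ℝ) +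
        (2 : ℝ≥0∞) ^ (1 / 2 : ℝ) *
          ((∫⁻ y in closedBall (x n) ρ, ‖Q y‖ₑ ^ (3 : ℝ)) ^ (1 / 2 : ℝ) *
              (volume (ball (x n) r)) ^ (1 / 2 : ℝ) +
            (ENNReal.ofReal κ * (∫⁻ y in closedBall (x n) ρ, ‖Q y‖ₑ ^ (3 : ℝ)) ^ (1 / 3 : ℝ)) ^
                (3 / 2 : ℝ) * volume (ball (x n) r))) atTop (𝓝 0) := by
  have hV : ∀ n, volume (ball (x n) r) = volume (ball (0 : EuclideanSpace ℝ (Fin 3)) r) :=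
    fun n => Measure.addHaar_ball_center volume (x n) r
  simp_rw [hV]
  set V : ℝ≥0∞ := volume (ball (0 : EuclideanSpace ℝ (Fin 3)) r) with hVdef
  have hVtop : V ≠ ⊤ := measure_ball_lt_top.ne
  have hV2top : V ^ (1 / 2 : ℝ) ≠ ⊤ := ENNReal.rpow_ne_top_of_nonneg (by norm_num) hVtop
  have ha := tendsto_setLIntegral_closedBall_of_norm_ge hv6 hx ρ
  have hb := tendsto_setLIntegral_closedBall_of_norm_ge hQ3 hx ρ
  -- each term
  have t1 : Tendsto (fun n => (∫⁻ y in closedBall (x n) ρ, ‖v y‖ₑ ^ 6) ^ (1 / 2 : ℝ) * V ^ (1 / 2 : ℝ))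
      atTop (𝓝 0) := by
    have h := ((ENNReal.continuous_rpow_const (y := (1 / 2 : ℝ))).tendsto 0).comp ha
    rw [ENNReal.zero_rpow_of_pos (by norm_num)] at h
    simpa using ENNReal.Tendsto.mul_const h (Or.inr hV2top)
  have t2 : Tendsto (fun n => (∫⁻ y in closedBall (x n) ρ, ‖Q y‖ₑ ^ (3 : ℝ)) ^ (1 / 2 : ℝ) *
      V ^ (1 / 2 : ℝ)) atTop (𝓝 0) := by
    have h := ((ENNReal.continuous_rpow_const (y := (1 / 2 : ℝ))).tendsto 0).comp hb
    rw [ENNReal.zero_rpow_of_pos (by norm_num)] at h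
    simpa using ENNReal.Tendsto.mul_const h (Or.inr hV2top)
  have t3 : Tendsto (fun n => (ENNReal.ofReal κ *
      (∫⁻ y in closedBall (x n) ρ, ‖Q y‖ₑ ^ (3 : ℝ)) ^ (1 / 3 : ℝ)) ^ (3 / 2 : ℝ) * V) atTop (𝓝 0) := by
    have h := ((ENNReal.continuous_rpow_const (y := (1 / 3 : ℝ))).tendsto 0).comp hb
    rw [ENNReal.zero_rpow_of_pos (by norm_num)] at h
    have h' := ENNReal.Tendsto.const_mul (a := ENNReal.ofReal κ) h (Or.inr ENNReal.ofReal_ne_top)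
    rw [mul_zero] at h'
    have h'' := ((ENNReal.continuous_rpow_const (y := (3 / 2 : ℝ))).tendsto 0).comp h'
    rw [ENNReal.zero_rpow_of_pos (by norm_num)] at h''
    simpa using ENNReal.Tendsto.mul_const h'' (Or.inr hVtop)
  have t4 := ENNReal.Tendsto.const_mul (t2.add t3) (Or.inr (ENNReal.rpow_ne_top_of_nonneg
    (by norm_num : (0 : ℝ) ≤ 1 / 2) (by norm_num : (2 : ℝ≥0∞) ≠ ⊤)))
  rw [add_zero, mul_zero] at t4
  simpa using t1.add t4

/-! ### Step C: domination by the Type-I slice rate -/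

/-- **Domination of the local slice bound by the global rates**: if `‖v‖_{L⁶} ≤ ℓ` and
`‖Q‖_{L³} ≤ C_q ℓ²`, the right-hand side of `sliceFunctional_le_local` is at most `ℓ³ · K₀` with an
`x₀`-independent finite constant `K₀`. -/
theorem sliceBound_local_le_rate {v : EuclideanSpace ℝ (Fin 3) → EuclideanSpace ℝ (Fin 3)}
    {Q : EuclideanSpace ℝ (Fin 3) → ℝ} (hv : AEStronglyMeasurable v volume)
    {ℓ Cq κ : ℝ} (hℓ : 0 ≤ ℓ) (hCq : 0 ≤ Cq) (hκ : 0 ≤ κ)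
    (h6 : eLpNorm v (ENNReal.ofReal 6) volume ≤ ENNReal.ofReal ℓ)
    (h3 : eLpNorm Q 3 volume ≤ ENNReal.ofReal (Cq * ℓ ^ 2)) (x₀ : EuclideanSpace ℝ (Fin 3))
    (ρ r : ℝ) :
    (∫⁻ y in closedBall x₀ ρ, ‖v y‖ₑ ^ 6) ^ (1 / 2 : ℝ) * (volume (ball x₀ r)) ^ (1 / 2 : ℝ) +
        (2 : ℝ≥0∞) ^ (1 / 2 : ℝ) *
          ((∫⁻ y in closedBall x₀ ρ, ‖Q y‖ₑ ^ (3 : ℝ)) ^ (1 / 2 : ℝ) * (volume (ball x₀ r)) ^ (1 / 2 : ℝ) +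
            (ENNReal.ofReal κ * (∫⁻ y in closedBall x₀ ρ, ‖Q y‖ₑ ^ (3 : ℝ)) ^ (1 / 3 : ℝ)) ^ (3 / 2 : ℝ) *
              volume (ball x₀ r)) ≤
      ENNReal.ofReal (ℓ ^ 3) *
        ((volume (ball (0 : EuclideanSpace ℝ (Fin 3)) r)) ^ (1 / 2 : ℝ) +
          (2 : ℝ≥0∞) ^ (1 / 2 : ℝ) * (ENNReal.ofReal (Cq ^ (3 / 2 : ℝ)) *
              (volume (ball (0 : EuclideanSpace ℝ (Fin 3)) r)) ^ (1 / 2 : ℝ) +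
            ENNReal.ofReal ((κ * Cq) ^ (3 / 2 : ℝ)) * volume (ball (0 : EuclideanSpace ℝ (Fin 3)) r))) := by
  rw [Measure.addHaar_ball_center volume x₀ r]
  set V : ℝ≥0∞ := volume (ball (0 : EuclideanSpace ℝ (Fin 3)) r) with hVdef
  -- `a^{1/2} ≤ ℓ³`
  have ha : (∫⁻ y in closedBall x₀ ρ, ‖v y‖ₑ ^ 6) ^ (1 / 2 : ℝ) ≤ ENNReal.ofReal (ℓ ^ 3) := by
    calc (∫⁻ y in closedBall x₀ ρ, ‖v y‖ₑ ^ 6) ^ (1 / 2 : ℝ) ≤ (∫⁻ y, ‖v y‖ₑ ^ 6) ^ (1 / 2 : ℝ) := by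
          gcongr; exact Measure.restrict_le_self
      _ = eLpNorm v (ENNReal.ofReal 6) volume ^ (3 : ℝ) := by
          rw [lintegral_enorm_pow_six_eq hv, ← ENNReal.rpow_mul]; norm_num
      _ ≤ ENNReal.ofReal ℓ ^ (3 : ℝ) := by gcongr
      _ = ENNReal.ofReal (ℓ ^ 3) := by
          rw [ENNReal.ofReal_rpow_of_nonneg hℓ (by norm_num)]; norm_num
  -- `b ≤ (Cq ℓ²)³`
  have hb : ∫⁻ y in closedBall x₀ ρ, ‖Q y‖ₑ ^ (3 : ℝ) ≤ ENNReal.ofReal (Cq * ℓ ^ 2) ^ (3 : ℝ) := by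
    calc ∫⁻ y in closedBall x₀ ρ, ‖Q y‖ₑ ^ (3 : ℝ) ≤ ∫⁻ y, ‖Q y‖ₑ ^ (3 : ℝ) :=
          setLIntegral_le_lintegral _ _
      _ = eLpNorm Q 3 volume ^ (3 : ℝ) := by
          rw [lintegral_rpow_enorm_eq_rpow_eLpNorm' (by norm_num : (0 : ℝ) < 3),
            eLpNorm_eq_eLpNorm' (by norm_num) (by norm_num)]
          norm_num
      _ ≤ ENNReal.ofReal (Cq * ℓ ^ 2) ^ (3 : ℝ) := by gcongr
  have hP0 : 0 ≤ Cq * ℓ ^ 2 := by positivity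
  have hb2 : (∫⁻ y in closedBall x₀ ρ, ‖Q y‖ₑ ^ (3 : ℝ)) ^ (1 / 2 : ℝ) ≤
      ENNReal.ofReal (Cq ^ (3 / 2 : ℝ)) * ENNReal.ofReal (ℓ ^ 3) := by
    calc (∫⁻ y in closedBall x₀ ρ, ‖Q y‖ₑ ^ (3 : ℝ)) ^ (1 / 2 : ℝ)
        ≤ (ENNReal.ofReal (Cq * ℓ ^ 2) ^ (3 : ℝ)) ^ (1 / 2 : ℝ) := by gcongr
      _ = ENNReal.ofReal ((Cq * ℓ ^ 2) ^ (3 / 2 : ℝ)) := by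
          rw [← ENNReal.rpow_mul, ENNReal.ofReal_rpow_of_nonneg hP0 (by norm_num)]; norm_num
      _ = ENNReal.ofReal (Cq ^ (3 / 2 : ℝ)) * ENNReal.ofReal (ℓ ^ 3) := by
          rw [mul_sq_rpow_threeHalves hCq hℓ, ENNReal.ofReal_mul (by positivity)]
  have hb3 : (ENNReal.ofReal κ * (∫⁻ y in closedBall x₀ ρ, ‖Q y‖ₑ ^ (3 : ℝ)) ^ (1 / 3 : ℝ)) ^ (3 / 2 : ℝ) ≤
      ENNReal.ofReal ((κ * Cq) ^ (3 / 2 : ℝ)) * ENNReal.ofReal (ℓ ^ 3) := by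
    have h1 : (∫⁻ y in closedBall x₀ ρ, ‖Q y‖ₑ ^ (3 : ℝ)) ^ (1 / 3 : ℝ) ≤ ENNReal.ofReal (Cq * ℓ ^ 2) := by
      calc (∫⁻ y in closedBall x₀ ρ, ‖Q y‖ₑ ^ (3 : ℝ)) ^ (1 / 3 : ℝ)
          ≤ (ENNReal.ofReal (Cq * ℓ ^ 2) ^ (3 : ℝ)) ^ (1 / 3 : ℝ) := by gcongr
        _ = ENNReal.ofReal (Cq * ℓ ^ 2) := by rw [← ENNReal.rpow_mul]; norm_num
    calc (ENNReal.ofReal κ * (∫⁻ y in closedBall x₀ ρ, ‖Q y‖ₑ ^ (3 : ℝ)) ^ (1 / 3 : ℝ)) ^ (3 / 2 : ℝ)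
        ≤ (ENNReal.ofReal κ * ENNReal.ofReal (Cq * ℓ ^ 2)) ^ (3 / 2 : ℝ) := by gcongr
      _ = ENNReal.ofReal ((κ * (Cq * ℓ ^ 2)) ^ (3 / 2 : ℝ)) := by
          rw [← ENNReal.ofReal_mul hκ, ENNReal.ofReal_rpow_of_nonneg (by positivity) (by norm_num)]
      _ = ENNReal.ofReal ((κ * Cq) ^ (3 / 2 : ℝ)) * ENNReal.ofReal (ℓ ^ 3) := by
          rw [show κ * (Cq * ℓ ^ 2) = (κ * Cq) * ℓ ^ 2 by ring,
            mul_sq_rpow_threeHalves (mul_nonneg hκ hCq) hℓ, ENNReal.ofReal_mul (by positivity)]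
  calc _ ≤ ENNReal.ofReal (ℓ ^ 3) * V ^ (1 / 2 : ℝ) +
        (2 : ℝ≥0∞) ^ (1 / 2 : ℝ) *
          (ENNReal.ofReal (Cq ^ (3 / 2 : ℝ)) * ENNReal.ofReal (ℓ ^ 3) * V ^ (1 / 2 : ℝ) +
            ENNReal.ofReal ((κ * Cq) ^ (3 / 2 : ℝ)) * ENNReal.ofReal (ℓ ^ 3) * V) := by
        gcongr
    _ = _ := by ring

/-! ### Step D0: one slice — domination and decay along escaping balls -/

/-- **One slice: domination and decay.** For a slice `v ∈ L⁶` (`‖v‖₆ ≤ ℓ`), a slice pressure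
`pr₀ = Q + C` a.e. with `‖Q‖₃ ≤ C_q ℓ²`, local gauges `mx(x₀) = ∫ Θ(y) pr₀(x₀ − y) dy` and a sequence
of centres `‖x_n‖ ≥ n`: the slice functionals `∫_{B(x_n, r)} (|v|³ + |pr₀ − mx(x_n)|^{3/2})` are
bounded by `ℓ³ K₀` (an absolute expression `K₀` in `r, Θ, B_Θ, C_q`) and tend to `0`. -/
theorem sliceFunctional_dominated_tendsto
    {v : EuclideanSpace ℝ (Fin 3) → EuclideanSpace ℝ (Fin 3)} {pr₀ Q : EuclideanSpace ℝ (Fin 3) → ℝ}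
    {Cc ℓ Cq BΘ r : ℝ} {θ : ContDiffBump (0 : EuclideanSpace ℝ (Fin 3))}
    {mx : EuclideanSpace ℝ (Fin 3) → ℝ} {x : ℕ → EuclideanSpace ℝ (Fin 3)}
    (hv : AEStronglyMeasurable v volume) (hQ : MemLp Q 3 volume)
    (hae : ∀ᵐ y ∂(volume : Measure (EuclideanSpace ℝ (Fin 3))), pr₀ y = Q y + Cc)
    (hℓ : 0 ≤ ℓ) (hCq : 0 ≤ Cq) (h6 : eLpNorm v (ENNReal.ofReal 6) volume ≤ ENNReal.ofReal ℓ)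
    (h3 : eLpNorm Q 3 volume ≤ ENNReal.ofReal (Cq * ℓ ^ 2))
    (hBΘ : ∀ y, θ.normed volume y ≤ BΘ)
    (hmx : ∀ x₀, mx x₀ = ∫ y, θ.normed volume y * pr₀ (x₀ - y)) (hr : r ≤ θ.rOut)
    (hx : ∀ n : ℕ, (n : ℝ) ≤ ‖x n‖) :
    (∀ n, ∫⁻ y in ball (x n) r, (‖v y‖ₑ ^ (3 : ℕ) + ‖pr₀ y - mx (x n)‖ₑ ^ (3 / 2 : ℝ)) ≤
        ENNReal.ofReal (ℓ ^ 3) *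
          ((volume (ball (0 : EuclideanSpace ℝ (Fin 3)) r)) ^ (1 / 2 : ℝ) +
            (2 : ℝ≥0∞) ^ (1 / 2 : ℝ) * (ENNReal.ofReal (Cq ^ (3 / 2 : ℝ)) *
                (volume (ball (0 : EuclideanSpace ℝ (Fin 3)) r)) ^ (1 / 2 : ℝ) +
              ENNReal.ofReal ((BΘ * (volume.real (closedBall (0 : EuclideanSpace ℝ (Fin 3)) θ.rOut)) ^
                  (2 / 3 : ℝ) * Cq) ^ (3 / 2 : ℝ)) * volume (ball (0 : EuclideanSpace ℝ (Fin 3)) r)))) ∧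
      Tendsto (fun n => ∫⁻ y in ball (x n) r, (‖v y‖ₑ ^ (3 : ℕ) + ‖pr₀ y - mx (x n)‖ₑ ^ (3 / 2 : ℝ)))
        atTop (𝓝 0) := by
  have hBΘ0 : 0 ≤ BΘ := (θ.nonneg_normed 0).trans (hBΘ 0)
  have hκ0 : 0 ≤ BΘ * (volume.real (closedBall (0 : EuclideanSpace ℝ (Fin 3)) θ.rOut)) ^ (2 / 3 : ℝ) := by
    positivity
  have hcb : ∀ x₀ : EuclideanSpace ℝ (Fin 3), volume.real (closedBall x₀ θ.rOut) =
      volume.real (closedBall (0 : EuclideanSpace ℝ (Fin 3)) θ.rOut) := fun x₀ => by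
    simp only [measureReal_def, Measure.addHaar_closedBall_center]
  -- Step A at every centre, with the `x₀`-free constant
  have hA : ∀ n, ∫⁻ y in ball (x n) r, (‖v y‖ₑ ^ (3 : ℕ) + ‖pr₀ y - mx (x n)‖ₑ ^ (3 / 2 : ℝ)) ≤
      (∫⁻ y in closedBall (x n) θ.rOut, ‖v y‖ₑ ^ 6) ^ (1 / 2 : ℝ) * (volume (ball (x n) r)) ^ (1 / 2 : ℝ) +
        (2 : ℝ≥0∞) ^ (1 / 2 : ℝ) *
          ((∫⁻ y in closedBall (x n) θ.rOut, ‖Q y‖ₑ ^ (3 : ℝ)) ^ (1 / 2 : ℝ) *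
              (volume (ball (x n) r)) ^ (1 / 2 : ℝ) +
            (ENNReal.ofReal (BΘ * (volume.real (closedBall (0 : EuclideanSpace ℝ (Fin 3)) θ.rOut)) ^
                (2 / 3 : ℝ)) * (∫⁻ y in closedBall (x n) θ.rOut, ‖Q y‖ₑ ^ (3 : ℝ)) ^ (1 / 3 : ℝ)) ^
                (3 / 2 : ℝ) * volume (ball (x n) r)) := by
    intro n
    have h := sliceFunctional_le_local hv hQ hae hBΘ (hmx (x n)) hr
    rw [hcb (x n)] at h
    exact h
  refine ⟨fun n => (hA n).trans (sliceBound_local_le_rate hv hℓ hCq hκ0 h6 h3 (x n) θ.rOut r), ?_⟩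
  -- decay
  have hv6 : ∫⁻ y, ‖v y‖ₑ ^ 6 ≠ ⊤ := by
    rw [lintegral_enorm_pow_six_eq hv]
    exact ENNReal.rpow_ne_top_of_nonneg (by norm_num)
      (ne_top_of_le_ne_top ENNReal.ofReal_ne_top h6)
  have hQ3 : ∫⁻ y, ‖Q y‖ₑ ^ (3 : ℝ) ≠ ⊤ := by
    have e : ∫⁻ y, ‖Q y‖ₑ ^ (3 : ℝ) = eLpNorm Q 3 volume ^ (3 : ℝ) := by
      rw [lintegral_rpow_enorm_eq_rpow_eLpNorm' (by norm_num : (0 : ℝ) < 3),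
        eLpNorm_eq_eLpNorm' (by norm_num) (by norm_num)]
      norm_num
    rw [e]
    exact ENNReal.rpow_ne_top_of_nonneg (by norm_num) hQ.eLpNorm_lt_top.ne
  have hB := tendsto_sliceBound_local hv6 hQ3 hx θ.rOut r
    (BΘ * (volume.real (closedBall (0 : EuclideanSpace ℝ (Fin 3)) θ.rOut)) ^ (2 / 3 : ℝ))
  exact tendsto_of_tendsto_of_tendsto_of_le_of_le tendsto_const_nhds hB (fun _ => zero_le) hA

end Summit.NavierStokesRegularity.NavierStokesRegularity.Theorems.FiniteDissipationLiouville.Birth.Apex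

end
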